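import Summits.ResolutionOfSingularities.ResolutionOfSingularities.Theorems.FrobeniusLadderFInjectiveMacaulayficationCNConeFiModelRel
import HarnessLib

/-!
# (H3-rel) WITH THE MODEL NAMED: the crux clause at EVERY stalk of `affineBlowup (I_A R)` — inputs for the STRONG⁺ wrapper
# (crux `FInjectiveMacaulayfication` stmt-ResolutionOfSingularities-15315, chain w45a, hole #3; CRUX-PLAN v7 R7.5 «a STRONG⁺ step
# with empty residual at the generic point of the axis»)

Support file for crux stmt-ResolutionOfSingularities-15315 (`FrobeniusLadder.FInjectiveMacaulayfication`), chain w45a, seat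
res-D-pv-017 AS res-L1-w45a-stub-5. [OURS · L1 W4.5a] — NOT a statement of any manuscript; AI-written, weaker than expert review.

The landed engines (E6‴ `BlowupFiModelOfCover.stub_blowupFiModelOfCover`, G5ᴾ, (H3-rel) `CNConeFiModelRel` p497132) conclude
`∃ X' π, …` and forget that `X' = affineBlowup I`. A STRONG⁺ step (`stub_confinedIsoStepStrongPlus`: the model is an ISOMORPHISM
exactly off `closure {η}` and is INTEGRAL) needs the model named, so this file re-runs the three short glue proofs with the
existential opened: §1 E6‴ named (`affineBlowup_fiClause_of_cover`); §2 the chart half of p497132 as a reusable lemma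
(`chartClause_of_cnData`); §3 the (G5ᴾ-rel) core named (`affineBlowup_fiClause_of_chartClauseRel`); §4 (H3-rel) named
(`affineBlowup_fiClause_of_cnData`). The companion file `…CNStrongPlusStepRel.lean` adds «iso off `V(I)`» (Stacks 02OS, tree
`affineBlowup.isIso_morphismRestrict_iSup`) and integrality (`affineBlowup.isIntegral`) and packages the STRONG⁺ step at the generic
point of the stratum `V(X_J) ∩ Spec R`. No definitions, no named facts. [folklore]
-/

-- single-problem summit: the doubled namespace component is forced
set_option linter.dupNamespace false

noncomputable section

open AlgebraicGeometry CategoryTheory Literature.AlgebraicGeometry.Resolution MvPolynomial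

namespace Summit.ResolutionOfSingularities.ResolutionOfSingularities.Theorems.FInjectiveMacaulayfication.CNConeFiModelRelBlowup

open Summit.ResolutionOfSingularities.ResolutionOfSingularities.Theorems.FInjectiveMacaulayfication

/-! ## §1 E6‴ with the model NAMED: the clause at every point of `affineBlowup I` -/

/-- **E6‴, named-model form**: under the hypotheses of `BlowupFiModelOfCover.stub_blowupFiModelOfCover` (radical sub-cover
of charts, full clause off `V(I)`, Cohen–Macaulay + Frobenius-closed clause on the image-model charts `R[I/vⱼ]`), EVERY stalk of
`affineBlowup I` is a domain satisfying the crux clause. Proof = the landed stub's, with the existential opened.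
[cite: StacksProject, Tag 0804] -/
theorem affineBlowup_fiClause_of_cover (p : ℕ) [Fact p.Prime] (R : Type) [CommRing R] [IsDomain R] [IsNoetherianRing R]
    [CharP R p] (I : Ideal R) (t : ℕ) (v : Fin t → R) (hv : ∀ j : Fin t, v j ∈ I) (hI : I ≠ ⊥) (hv0 : ∀ j : Fin t, v j ≠ 0)
    (hcov : (HomogeneousIdeal.irrelevant (reesGrading I)).toIdeal ≤
      (Ideal.span (Set.range fun j : Fin t => reesT (I := I) (v j) (hv j))).radical)
    (hoff : ∀ (P : Ideal R) [P.IsPrime], ¬ I ≤ P →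
      IsDomain (Localization.AtPrime P) ∧
      ∀ d : ℕ, ringKrullDim (Localization.AtPrime P) = d → ∀ s : Fin d → Localization.AtPrime P,
        (Ideal.span (Set.range s)).radical.IsMaximal →
          RingTheory.Sequence.IsWeaklyRegular (Localization.AtPrime P) (List.ofFn s) ∧
          ∀ y : Localization.AtPrime P, (∃ e : ℕ, y ^ p ^ e ∈ Ideal.span
            ((fun z : Localization.AtPrime P => z ^ p ^ e) ''
              (Ideal.span (Set.range s) : Set (Localization.AtPrime P)))) → y ∈ Ideal.span (Set.range s))
    (hon : ∀ (j : Fin t) (Q : Ideal (blowupAlgebra I (v j))) [Q.IsMaximal],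
      algebraMap R (blowupAlgebra I (v j)) (v j) ∈ Q →
      ∀ d : ℕ, ringKrullDim (Localization.AtPrime Q) = d → ∀ s : Fin d → Localization.AtPrime Q,
        (Ideal.span (Set.range s)).radical.IsMaximal →
          RingTheory.Sequence.IsWeaklyRegular (Localization.AtPrime Q) (List.ofFn s) ∧
          ∀ y : Localization.AtPrime Q, (∃ e : ℕ, y ^ p ^ e ∈ Ideal.span
            ((fun z : Localization.AtPrime Q => z ^ p ^ e) ''
              (Ideal.span (Set.range s) : Set (Localization.AtPrime Q)))) → y ∈ Ideal.span (Set.range s)) :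
    ∀ y : ↥(affineBlowup I), IsDomain ((affineBlowup I).presheaf.stalk y) ∧
      ∀ d : ℕ, ringKrullDim ((affineBlowup I).presheaf.stalk y) = d →
        ∀ s : Fin d → (affineBlowup I).presheaf.stalk y, (Ideal.span (Set.range s)).radical.IsMaximal →
          RingTheory.Sequence.IsWeaklyRegular ((affineBlowup I).presheaf.stalk y) (List.ofFn s) ∧
          ∀ z : (affineBlowup I).presheaf.stalk y, (∃ e : ℕ, z ^ p ^ e ∈
              Ideal.span ((fun w : (affineBlowup I).presheaf.stalk y => w ^ p ^ e) ''
                (Ideal.span (Set.range s) : Set ((affineBlowup I).presheaf.stalk y)))) →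
            z ∈ Ideal.span (Set.range s) := by
  have _ := hI
  intro y
  obtain ⟨j, q, ⟨e⟩⟩ := BlowupFiModelOfCover.exists_stalk_ringEquiv_of_cover v hv hcov y
  have hoff' : ∀ (P : Ideal R) [P.IsPrime], v j ∉ P →
      IsDomain (Localization.AtPrime P) ∧
      ∀ d : ℕ, ringKrullDim (Localization.AtPrime P) = d → ∀ s : Fin d → Localization.AtPrime P,
        (Ideal.span (Set.range s)).radical.IsMaximal →
          RingTheory.Sequence.IsWeaklyRegular (Localization.AtPrime P) (List.ofFn s) ∧
          ∀ y : Localization.AtPrime P, (∃ e : ℕ, y ^ p ^ e ∈ Ideal.span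
            ((fun z : Localization.AtPrime P => z ^ p ^ e) ''
              (Ideal.span (Set.range s) : Set (Localization.AtPrime P)))) → y ∈ Ideal.span (Set.range s) :=
    fun P _ hxP => hoff P fun hle => hxP (hle (hv j))
  obtain ⟨hdom, hq⟩ := BlowupFiModel.chart_fiClause_of_maximal p (v j) (hv j) (hv0 j) hoff'
    (fun Q _ haQ => BlowupFiModelOfCover.chartClause_of_blowupAlgebraClause p (v j) (hv j) (hon j) Q haQ) q.asIdeal
  haveI := hdom
  exact ⟨MulEquiv.isDomain (Localization.AtPrime q.asIdeal) e.toMulEquiv,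
    DegreeZeroDescent.inlineClause_of_ringEquiv p e.symm hq⟩

/-! ## §2 The chart clause `hon` from the Cartier–Newton data (the chart half of `CNConeFiModelRel.cnConeFiModelRel`) -/

set_option maxHeartbeats 800000 in
/-- **The chart clause from the CN data, relative to `J`.** Under the global data of (H3-rel) — unimodular `V_c`, vertex `m_c`,
neighbours `a_c i` with (hgen)/(h≥), `θ_c f = y^(dv c) · g_c` with no `yᵢ ∣ g_c`, a simultaneous minimiser, (prim) on `J`, the
Cartier–Newton faces positive on `J`, `(f)` prime with all `x̄ⱼ ≠ 0` — every vertex chart `R[I_A R/x̄^(m_c)]` satisfies the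
Cohen–Macaulay + Frobenius-closed clause at its maximal ideals containing `x̄^(m_c)/1`. This is the chart half of the proof of
`CNConeFiModelRel.cnConeFiModelRel` (p497132), stated on its own so that NAMED-model consumers can reuse it. [folklore] -/
theorem chartClause_of_cnData (p : ℕ) [Fact p.Prime] (k : Type) [Field k] [CharP k p] (n : ℕ) (J : Finset (Fin n))
    (hJ : J.Nonempty) (A : Finset (Fin n →₀ ℕ)) (hprim : ∀ j ∈ J, ∃ e : ℕ, 0 < e ∧ Finsupp.single j e ∈ A)
    (t : ℕ) (V : Fin t → Matrix (Fin n) (Fin n) ℕ) (hV : ∀ c, IsUnit ((V c).map (Nat.cast : ℕ → ℤ)).det)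
    (m : Fin t → (Fin n →₀ ℕ)) (a : Fin t → Fin n → (Fin n →₀ ℕ)) (haA : ∀ c i, a c i ∈ A)
    (hgen : ∀ (c : Fin t) (i : Fin n), (Finsupp.equivFunOnFinite.symm ((V c).mulVec ⇑(a c i)) : Fin n →₀ ℕ) =
      Finsupp.equivFunOnFinite.symm ((V c).mulVec ⇑(m c)) + Finsupp.single i 1)
    (hge : ∀ (c : Fin t), ∀ e ∈ A, (Finsupp.equivFunOnFinite.symm ((V c).mulVec ⇑(m c)) : Fin n →₀ ℕ) ≤
      Finsupp.equivFunOnFinite.symm ((V c).mulVec ⇑e))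
    (f : MvPolynomial (Fin n) k) (hfprime : (Ideal.span {f}).IsPrime)
    (hXne : ∀ v : Fin n, Ideal.Quotient.mk (Ideal.span {f}) (MvPolynomial.X v) ≠ 0)
    (hCN : ∀ (c : Fin t) (S : Finset (Fin n)), (∀ j ∈ J, 0 < ∑ i ∈ S, V c i j) →
      (∀ D : ℕ, (MvPolynomial.weightedHomogeneousComponent (fun j : Fin n => ∑ i ∈ S, V c i j) D f ≠ 0 ∧
          ∀ D' < D, MvPolynomial.weightedHomogeneousComponent (fun j : Fin n => ∑ i ∈ S, V c i j) D' f = 0) →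
        ∀ (K : Type) [Field K] [Algebra k K] (b : Fin n → K), (∀ i, b i ≠ 0) →
          MvPolynomial.aeval b (MvPolynomial.weightedHomogeneousComponent (fun j : Fin n => ∑ i ∈ S, V c i j) D f) = 0 →
          (MvPolynomial.map (algebraMap k K) (MvPolynomial.weightedHomogeneousComponent (fun j : Fin n => ∑ i ∈ S, V c i j) D f)) ^ (p - 1) ∉
            Ideal.span (Set.range fun i : Fin n => (MvPolynomial.X i - MvPolynomial.C (b i)) ^ p)))
    (dv : Fin t → (Fin n →₀ ℕ)) (g : Fin t → MvPolynomial (Fin n) k)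
    (hg : ∀ c, MvPolynomial.aeval (fun j : Fin n => ∏ i : Fin n, (MvPolynomial.X i : MvPolynomial (Fin n) k) ^ V c i j) f = MvPolynomial.monomial (dv c) 1 * g c)
    (hndiv : ∀ c, ∀ i : Fin n, ¬ (MvPolynomial.X i ∣ g c))
    (hface : ∀ c, ∃ m ∈ f.support, ∀ i : Fin n, ∑ j : Fin n, V c i j * m j = dv c i)
    (c : Fin t) (Q : Ideal (blowupAlgebra (Ideal.span ((fun b : Fin n →₀ ℕ => Ideal.Quotient.mk (Ideal.span {f}) (MvPolynomial.monomial b (1 : k))) '' (A : Set (Fin n →₀ ℕ)))) (Ideal.Quotient.mk (Ideal.span {f}) (MvPolynomial.monomial (m c) 1)))) [Q.IsMaximal]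
    (hQ : algebraMap (MvPolynomial (Fin n) k ⧸ Ideal.span {f}) (blowupAlgebra (Ideal.span ((fun b : Fin n →₀ ℕ => Ideal.Quotient.mk (Ideal.span {f}) (MvPolynomial.monomial b (1 : k))) '' (A : Set (Fin n →₀ ℕ)))) (Ideal.Quotient.mk (Ideal.span {f}) (MvPolynomial.monomial (m c) 1))) (Ideal.Quotient.mk (Ideal.span {f}) (MvPolynomial.monomial (m c) 1)) ∈ Q) :
      ∀ d : ℕ, ringKrullDim (Localization.AtPrime Q) = d → ∀ s : Fin d → Localization.AtPrime Q,
        (Ideal.span (Set.range s)).radical.IsMaximal →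
          RingTheory.Sequence.IsWeaklyRegular (Localization.AtPrime Q) (List.ofFn s) ∧
          ∀ y : Localization.AtPrime Q, (∃ e : ℕ, y ^ p ^ e ∈ Ideal.span
            ((fun z : Localization.AtPrime Q => z ^ p ^ e) ''
              (Ideal.span (Set.range s) : Set (Localization.AtPrime Q)))) → y ∈ Ideal.span (Set.range s) := by
  haveI := hfprime
  haveI : IsDomain (MvPolynomial (Fin n) k ⧸ Ideal.span {f}) := Ideal.Quotient.isDomain _
  obtain ⟨j₀, hj₀⟩ := hJ
  have hg0 : g c ≠ 0 := fun h0 => hndiv c j₀ (h0 ▸ dvd_zero _)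
  -- the presentation of chart `c` (C1 prime form, landed), upgraded to a ring equivalence
  obtain ⟨e₀, hbij, heθ⟩ := MonomialChartPresentationPrime.exists_monomialChartPresentation_of_isPrime f (V c) (hV c) (m c) (a c)
    (hgen c) A (haA c) (hge c) (dv c) (g c) (hg c) hfprime hXne (hndiv c)
  obtain ⟨e, he⟩ : ∃ e : (MvPolynomial (Fin n) k ⧸ Ideal.span {g c}) ≃+* ↥(blowupAlgebra (Ideal.span ((fun b : Fin n →₀ ℕ => Ideal.Quotient.mk (Ideal.span {f}) (MvPolynomial.monomial b (1 : k))) '' (A : Set (Fin n →₀ ℕ)))) (Ideal.Quotient.mk (Ideal.span {f}) (MvPolynomial.monomial (m c) 1))),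
      ∀ x, e x = e₀ x := ⟨RingEquiv.ofBijective e₀ hbij, fun x => rfl⟩
  -- `(g c)` is prime: `k[y]/(g c)` is isomorphic to a subring of the domain `R[1/x̄^(m c)]`
  haveI : IsDomain (Localization.Away (Ideal.Quotient.mk (Ideal.span {f}) (MvPolynomial.monomial (m c) (1 : k)))) :=
    IsLocalization.isDomain_localization
      (powers_le_nonZeroDivisors_of_noZeroDivisors (CNConeFiModel.mk_monomial_ne_zero f hXne (m c)))
  haveI : IsDomain (MvPolynomial (Fin n) k ⧸ Ideal.span {g c}) := e.toMulEquiv.isDomain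
  haveI hgp : (Ideal.span {g c}).IsPrime := (Ideal.Quotient.isDomain_iff_prime _).mp inferInstance
  -- `Q' = e⁻¹ Q` is maximal
  haveI hQ' : (Q.comap e.toRingHom).IsMaximal := Ideal.comap_isMaximal_of_equiv e
  -- every `θ(X_j)`, `j ∈ J`, lies in `Q'`: `(x̄ⱼ/1)^ε = (x̄ⱼ^ε/x̄^m) · (x̄^m/1) ∈ Q` ((prim) on `J`)
  have hXQ : ∀ j ∈ J,
      Ideal.Quotient.mk (Ideal.span {g c}) (∏ i : Fin n, MvPolynomial.X i ^ V c i j) ∈ Q.comap e.toRingHom := by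
    intro j hj
    obtain ⟨ε, hε, hεA⟩ := hprim j hj
    have hz : algebraMap (MvPolynomial (Fin n) k ⧸ Ideal.span {f}) (Localization.Away (Ideal.Quotient.mk (Ideal.span {f}) (MvPolynomial.monomial (m c) (1 : k))))
        (Ideal.Quotient.mk (Ideal.span {f}) (MvPolynomial.X j ^ ε)) * IsLocalization.Away.invSelf (Ideal.Quotient.mk (Ideal.span {f}) (MvPolynomial.monomial (m c) (1 : k))) ∈
        blowupAlgebra (Ideal.span ((fun b : Fin n →₀ ℕ => Ideal.Quotient.mk (Ideal.span {f}) (MvPolynomial.monomial b (1 : k))) '' (A : Set (Fin n →₀ ℕ)))) (Ideal.Quotient.mk (Ideal.span {f}) (MvPolynomial.monomial (m c) 1)) := by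
      refine div_mem_blowupAlgebra _ _ (Ideal.subset_span ⟨Finsupp.single j ε, hεA, ?_⟩)
      show Ideal.Quotient.mk (Ideal.span {f}) (MvPolynomial.monomial (Finsupp.single j ε) (1 : k)) = _
      rw [X_pow_eq_monomial]
    have hprod : (⟨_, hz⟩ : ↥(blowupAlgebra (Ideal.span ((fun b : Fin n →₀ ℕ => Ideal.Quotient.mk (Ideal.span {f}) (MvPolynomial.monomial b (1 : k))) '' (A : Set (Fin n →₀ ℕ)))) (Ideal.Quotient.mk (Ideal.span {f}) (MvPolynomial.monomial (m c) 1)))) *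
        algebraMap (MvPolynomial (Fin n) k ⧸ Ideal.span {f}) _ (Ideal.Quotient.mk (Ideal.span {f}) (MvPolynomial.monomial (m c) 1)) =
        (algebraMap (MvPolynomial (Fin n) k ⧸ Ideal.span {f}) _ (Ideal.Quotient.mk (Ideal.span {f}) (MvPolynomial.X j))) ^ ε := by
      apply Subtype.ext
      simp only [Subalgebra.coe_mul, Subalgebra.coe_algebraMap, SubmonoidClass.coe_pow]
      rw [← map_pow, ← map_pow]
      exact div_mul_algebraMap _ _
    have hmem : (algebraMap (MvPolynomial (Fin n) k ⧸ Ideal.span {f}) ↥(blowupAlgebra (Ideal.span ((fun b : Fin n →₀ ℕ => Ideal.Quotient.mk (Ideal.span {f}) (MvPolynomial.monomial b (1 : k))) '' (A : Set (Fin n →₀ ℕ)))) (Ideal.Quotient.mk (Ideal.span {f}) (MvPolynomial.monomial (m c) 1))) (Ideal.Quotient.mk (Ideal.span {f}) (MvPolynomial.X j))) ^ ε ∈ Q := by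
      rw [← hprod]
      exact Q.mul_mem_left _ hQ
    have hXjQ := (inferInstance : Q.IsPrime).mem_of_pow_mem _ hmem
    rw [Ideal.mem_comap]
    have hej : e.toRingHom (Ideal.Quotient.mk (Ideal.span {g c}) (∏ i : Fin n, MvPolynomial.X i ^ V c i j)) =
        algebraMap (MvPolynomial (Fin n) k ⧸ Ideal.span {f}) ↥(blowupAlgebra (Ideal.span ((fun b : Fin n →₀ ℕ => Ideal.Quotient.mk (Ideal.span {f}) (MvPolynomial.monomial b (1 : k))) '' (A : Set (Fin n →₀ ℕ)))) (Ideal.Quotient.mk (Ideal.span {f}) (MvPolynomial.monomial (m c) 1))) (Ideal.Quotient.mk (Ideal.span {f}) (MvPolynomial.X j)) := by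
      apply Subtype.ext
      rw [Subalgebra.coe_algebraMap]
      have h1 := heθ (MvPolynomial.X j)
      rw [MvPolynomial.aeval_X] at h1
      rw [RingEquiv.toRingHom_eq_coe, RingHom.coe_coe, he]
      exact h1
    rw [hej]
    exact hXjQ
  -- the clause at `Q'` (G4ᴾ-rel), transported along `k[y]/(g c)_(Q') ≅ (chart)_Q`
  have hcl := CNConeFiModelRel.cnChartClauseRel p k n J ⟨j₀, hj₀⟩ f (V c) (hV c) (dv c) (g c) hgp (hg c) hg0
    (fun S hS => hCN c S hS) (hface c) (Q.comap e.toRingHom) hXQ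
  obtain ⟨eL⟩ := BlowupFiModelOfCover.nonempty_ringEquiv_localization_of_ringEquiv e (Q.comap e.toRingHom) Q
    (fun x => Iff.rfl)
  exact DegreeZeroDescent.inlineClause_of_ringEquiv p eL hcl

/-! ## §3 (G5ᴾ-rel core) with the model NAMED `affineBlowup (I_A R)` -/

/-- **(G5ᴾ-rel core), named-model form**: the hypotheses of `CNConeFiModelRel.cnConeFiModelRel_of_chartClause` (p497132)
give the crux clause at EVERY stalk of the blow-up `affineBlowup I`, `I = I_A R` (the existential of p497132 opened; same proof,
ending in `affineBlowup_fiClause_of_cover`). [folklore] -/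
theorem affineBlowup_fiClause_of_chartClauseRel (p : ℕ) [Fact p.Prime] (k : Type) [Field k] [CharP k p] (n : ℕ) (J : Finset (Fin n))
    (A : Finset (Fin n →₀ ℕ)) (hAJ : ∀ a ∈ A, ∃ j ∈ J, 0 < a j)
    (t : ℕ) (ht : 0 < t) (m : Fin t → (Fin n →₀ ℕ)) (hm : ∀ c : Fin t, m c ∈ A)
    (hcov : ∀ a ∈ A, ∃ (c : Fin t) (K : ℕ), 1 ≤ K ∧ ∃ y ∈ (Ideal.span ((fun b : Fin n →₀ ℕ => (MvPolynomial.monomial b (1 : k) : MvPolynomial (Fin n) k)) '' (A : Set (Fin n →₀ ℕ)))) ^ (K - 1),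
      (MvPolynomial.monomial a (1 : k) : MvPolynomial (Fin n) k) ^ K = MvPolynomial.monomial (m c) 1 * y)
    (f : MvPolynomial (Fin n) k) (hfprime : (Ideal.span {f}).IsPrime)
    (hXne : ∀ v : Fin n, Ideal.Quotient.mk (Ideal.span {f}) (MvPolynomial.X v) ≠ 0)
    (hoff : ∀ (Q : Ideal (MvPolynomial (Fin n) k ⧸ Ideal.span {f})) [Q.IsMaximal],
      (∃ j ∈ J, Ideal.Quotient.mk (Ideal.span {f}) (MvPolynomial.X j) ∉ Q) →
      ∀ d : ℕ, ringKrullDim (Localization.AtPrime Q) = d → ∀ s : Fin d → Localization.AtPrime Q,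
        (Ideal.span (Set.range s)).radical.IsMaximal →
          RingTheory.Sequence.IsWeaklyRegular (Localization.AtPrime Q) (List.ofFn s) ∧
          ∀ y : Localization.AtPrime Q, (∃ e : ℕ, y ^ p ^ e ∈ Ideal.span
            ((fun z : Localization.AtPrime Q => z ^ p ^ e) ''
              (Ideal.span (Set.range s) : Set (Localization.AtPrime Q)))) → y ∈ Ideal.span (Set.range s))
    (hon : ∀ (c : Fin t) (Q : Ideal (blowupAlgebra (Ideal.span ((fun b : Fin n →₀ ℕ => Ideal.Quotient.mk (Ideal.span {f}) (MvPolynomial.monomial b (1 : k))) '' (A : Set (Fin n →₀ ℕ)))) (Ideal.Quotient.mk (Ideal.span {f}) (MvPolynomial.monomial (m c) 1)))) [Q.IsMaximal],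
      algebraMap (MvPolynomial (Fin n) k ⧸ Ideal.span {f}) (blowupAlgebra (Ideal.span ((fun b : Fin n →₀ ℕ => Ideal.Quotient.mk (Ideal.span {f}) (MvPolynomial.monomial b (1 : k))) '' (A : Set (Fin n →₀ ℕ)))) (Ideal.Quotient.mk (Ideal.span {f}) (MvPolynomial.monomial (m c) 1))) (Ideal.Quotient.mk (Ideal.span {f}) (MvPolynomial.monomial (m c) 1)) ∈ Q →
      ∀ d : ℕ, ringKrullDim (Localization.AtPrime Q) = d → ∀ s : Fin d → Localization.AtPrime Q,
        (Ideal.span (Set.range s)).radical.IsMaximal →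
          RingTheory.Sequence.IsWeaklyRegular (Localization.AtPrime Q) (List.ofFn s) ∧
          ∀ y : Localization.AtPrime Q, (∃ e : ℕ, y ^ p ^ e ∈ Ideal.span
            ((fun z : Localization.AtPrime Q => z ^ p ^ e) ''
              (Ideal.span (Set.range s) : Set (Localization.AtPrime Q)))) → y ∈ Ideal.span (Set.range s))
    (I : Ideal (MvPolynomial (Fin n) k ⧸ Ideal.span {f}))
    (hI : I = Ideal.span ((fun b : Fin n →₀ ℕ => Ideal.Quotient.mk (Ideal.span {f}) (MvPolynomial.monomial b (1 : k))) '' (A : Set (Fin n →₀ ℕ)))) :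
    ∀ y : ↥(affineBlowup I), IsDomain ((affineBlowup I).presheaf.stalk y) ∧
      ∀ d : ℕ, ringKrullDim ((affineBlowup I).presheaf.stalk y) = d →
        ∀ s : Fin d → (affineBlowup I).presheaf.stalk y, (Ideal.span (Set.range s)).radical.IsMaximal →
          RingTheory.Sequence.IsWeaklyRegular ((affineBlowup I).presheaf.stalk y) (List.ofFn s) ∧
          ∀ z : (affineBlowup I).presheaf.stalk y, (∃ e : ℕ, z ^ p ^ e ∈
              Ideal.span ((fun w : (affineBlowup I).presheaf.stalk y => w ^ p ^ e) ''
                (Ideal.span (Set.range s) : Set ((affineBlowup I).presheaf.stalk y)))) →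
            z ∈ Ideal.span (Set.range s) := by
  haveI := hfprime
  haveI : IsDomain (MvPolynomial (Fin n) k ⧸ Ideal.span {f}) := Ideal.Quotient.isDomain _
  haveI : CharP (MvPolynomial (Fin n) k ⧸ Ideal.span {f}) p :=
    charP_of_injective_algebraMap (algebraMap k (MvPolynomial (Fin n) k ⧸ Ideal.span {f})).injective p
  -- the covering sub-family `v c = x̄ ^ (m c)` of the centre `I = I_A · R`
  -- the same ideal written as an extension
  have hImap : I = (Ideal.span ((fun b : Fin n →₀ ℕ => (MvPolynomial.monomial b (1 : k) : MvPolynomial (Fin n) k)) '' (A : Set (Fin n →₀ ℕ)))).map (Ideal.Quotient.mk (Ideal.span {f})) := by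
    rw [hI, Ideal.map_span, Set.image_image]
  obtain ⟨v, hv⟩ : ∃ v : Fin t → MvPolynomial (Fin n) k ⧸ Ideal.span {f},
      v = fun c => Ideal.Quotient.mk (Ideal.span {f}) (MvPolynomial.monomial (m c) 1) := ⟨_, rfl⟩
  have hvI : ∀ c : Fin t, v c ∈ I := by
    intro c
    rw [hv, hI]
    exact Ideal.subset_span ⟨m c, hm c, rfl⟩
  have hv0 : ∀ c : Fin t, v c ≠ 0 := fun c => by
    rw [hv]
    exact CNConeFiModel.mk_monomial_ne_zero f hXne (m c)
  have hI0 : I ≠ ⊥ := fun h => hv0 ⟨0, ht⟩ (by simpa [h] using hvI ⟨0, ht⟩)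
  -- the centre lies in the ideal of the `J`-variables (every generator involves a `J`-variable)
  have hIle : I ≤ Ideal.span ((fun j : Fin n => Ideal.Quotient.mk (Ideal.span {f}) (MvPolynomial.X j)) '' (J : Set (Fin n))) := by
    rw [hImap, show ((fun j : Fin n => Ideal.Quotient.mk (Ideal.span {f}) (MvPolynomial.X j)) '' (J : Set (Fin n))) =
      Ideal.Quotient.mk (Ideal.span {f}) '' ((fun j : Fin n => (X j : MvPolynomial (Fin n) k)) '' (J : Set (Fin n))) from
      by rw [Set.image_image], ← Ideal.map_span]
    refine Ideal.map_mono ?_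
    rw [Ideal.span_le]
    rintro _ ⟨b, hb, rfl⟩
    obtain ⟨j, hj, hbj⟩ := hAJ b hb
    -- `x^b = X_j · x^(b - e_j)`
    have hXj : (X j : MvPolynomial (Fin n) k) ∈ Ideal.span ((fun j : Fin n => (X j : MvPolynomial (Fin n) k)) '' (J : Set (Fin n))) :=
      Ideal.subset_span ⟨j, hj, rfl⟩
    have hle : Finsupp.single j 1 ≤ b := by
      rw [Finsupp.single_le_iff]
      exact hbj
    have heq : (MvPolynomial.monomial b (1 : k) : MvPolynomial (Fin n) k) =
        MvPolynomial.monomial (b - Finsupp.single j 1) (1 : k) * X j := by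
      rw [X, monomial_mul, mul_one, tsub_add_cancel_of_le hle]
    show (MvPolynomial.monomial b (1 : k) : MvPolynomial (Fin n) k) ∈
      Ideal.span ((fun j : Fin n => (X j : MvPolynomial (Fin n) k)) '' (J : Set (Fin n)))
    rw [heq]
    exact Ideal.mul_mem_left _ _ hXj
  -- THE COVER, read off the identities `(x^a)^K = x^(m c) · y`
  have hcov' : (HomogeneousIdeal.irrelevant (reesGrading I)).toIdeal ≤
      (Ideal.span (Set.range fun c : Fin t => reesT (I := I) (v c) (hvI c))).radical := by
    refine ReesCoverOfPowers.stub_reesCoverOfPowers _ I (Ideal.Quotient.mk (Ideal.span {f}) '' ((fun b : Fin n →₀ ℕ => (MvPolynomial.monomial b (1 : k) : MvPolynomial (Fin n) k)) '' (A : Set (Fin n →₀ ℕ)))) (by rw [hImap, Ideal.map_span]) t v hvI ?_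
    rintro _ ⟨_, ⟨a, ha, rfl⟩, rfl⟩
    obtain ⟨c, K, hK, y, hy, hEq⟩ := hcov a ha
    refine ⟨c, K, hK, Ideal.Quotient.mk (Ideal.span {f}) y, ?_, ?_⟩
    · rw [hImap, ← Ideal.map_pow]
      exact Ideal.mem_map_of_mem _ hy
    · rw [hv]
      show _ = Ideal.Quotient.mk (Ideal.span {f}) (MvPolynomial.monomial (m c) 1) * _
      rw [← map_pow, hEq, map_mul]
  -- OFF THE CENTRE (Jacobson, relative to `J`)
  have hoff' : ∀ (P : Ideal (MvPolynomial (Fin n) k ⧸ Ideal.span {f})) [P.IsPrime], ¬ I ≤ P →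
      IsDomain (Localization.AtPrime P) ∧
      ∀ d : ℕ, ringKrullDim (Localization.AtPrime P) = d → ∀ s : Fin d → Localization.AtPrime P,
        (Ideal.span (Set.range s)).radical.IsMaximal →
          RingTheory.Sequence.IsWeaklyRegular (Localization.AtPrime P) (List.ofFn s) ∧
          ∀ y : Localization.AtPrime P, (∃ e : ℕ, y ^ p ^ e ∈ Ideal.span
            ((fun z : Localization.AtPrime P => z ^ p ^ e) ''
              (Ideal.span (Set.range s) : Set (Localization.AtPrime P)))) → y ∈ Ideal.span (Set.range s) := by
    intro P _ hP
    obtain ⟨Q, hQ, hPQ, j, hj, hjQ⟩ := CNConeFiModelRel.exists_maximal_not_mem_X_of_le f J I hIle P hP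
    haveI := hQ
    exact ClauseOfMaximal.fiClause_atPrime_of_le p hPQ ⟨inferInstance, hoff Q ⟨j, hj, hjQ⟩⟩
  -- ON THE EXCEPTIONAL LOCUS, chart by chart
  have hon' : ∀ (c : Fin t) (Q : Ideal (blowupAlgebra I (v c))) [Q.IsMaximal],
      algebraMap (MvPolynomial (Fin n) k ⧸ Ideal.span {f}) (blowupAlgebra I (v c)) (v c) ∈ Q →
      ∀ d : ℕ, ringKrullDim (Localization.AtPrime Q) = d → ∀ s : Fin d → Localization.AtPrime Q,
        (Ideal.span (Set.range s)).radical.IsMaximal →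
          RingTheory.Sequence.IsWeaklyRegular (Localization.AtPrime Q) (List.ofFn s) ∧
          ∀ y : Localization.AtPrime Q, (∃ e : ℕ, y ^ p ^ e ∈ Ideal.span
            ((fun z : Localization.AtPrime Q => z ^ p ^ e) ''
              (Ideal.span (Set.range s) : Set (Localization.AtPrime Q)))) → y ∈ Ideal.span (Set.range s) := by
    subst hI hv
    intro c Q _ hQ
    exact hon c Q hQ
  exact affineBlowup_fiClause_of_cover p (MvPolynomial (Fin n) k ⧸ Ideal.span {f}) I t v hvI hI0 hv0 hcov' hoff' hon'

/-! ## §4 (H3-rel) with the model NAMED -/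

/-- **(H3-rel), named-model form**: under the data of `CNConeFiModelRel.cnConeFiModelRel` (p497132) the blow-up `affineBlowup (I_A R)`
itself satisfies the crux clause at every stalk (§3 + §2). [folklore] -/
theorem affineBlowup_fiClause_of_cnData (p : ℕ) [Fact p.Prime] (k : Type) [Field k] [CharP k p] (n : ℕ) (J : Finset (Fin n))
    (hJ : J.Nonempty) (A : Finset (Fin n →₀ ℕ)) (hAJ : ∀ a ∈ A, ∃ j ∈ J, 0 < a j)
    (hprim : ∀ j ∈ J, ∃ e : ℕ, 0 < e ∧ Finsupp.single j e ∈ A)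
    (t : ℕ) (ht : 0 < t) (V : Fin t → Matrix (Fin n) (Fin n) ℕ) (hV : ∀ c, IsUnit ((V c).map (Nat.cast : ℕ → ℤ)).det)
    (m : Fin t → (Fin n →₀ ℕ)) (hm : ∀ c, m c ∈ A) (a : Fin t → Fin n → (Fin n →₀ ℕ)) (haA : ∀ c i, a c i ∈ A)
    (hgen : ∀ (c : Fin t) (i : Fin n), (Finsupp.equivFunOnFinite.symm ((V c).mulVec ⇑(a c i)) : Fin n →₀ ℕ) =
      Finsupp.equivFunOnFinite.symm ((V c).mulVec ⇑(m c)) + Finsupp.single i 1)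
    (hge : ∀ (c : Fin t), ∀ e ∈ A, (Finsupp.equivFunOnFinite.symm ((V c).mulVec ⇑(m c)) : Fin n →₀ ℕ) ≤
      Finsupp.equivFunOnFinite.symm ((V c).mulVec ⇑e))
    (hcov : ∀ e ∈ A, ∃ (c : Fin t) (K : ℕ), 1 ≤ K ∧ ∃ y ∈ (Ideal.span ((fun b : Fin n →₀ ℕ => (MvPolynomial.monomial b (1 : k) : MvPolynomial (Fin n) k)) '' (A : Set (Fin n →₀ ℕ)))) ^ (K - 1),
      (MvPolynomial.monomial e (1 : k) : MvPolynomial (Fin n) k) ^ K = MvPolynomial.monomial (m c) 1 * y)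
    (f : MvPolynomial (Fin n) k) (hfprime : (Ideal.span {f}).IsPrime)
    (hXne : ∀ v : Fin n, Ideal.Quotient.mk (Ideal.span {f}) (MvPolynomial.X v) ≠ 0)
    (hoff : ∀ (Q : Ideal (MvPolynomial (Fin n) k ⧸ Ideal.span {f})) [Q.IsMaximal],
      (∃ j ∈ J, Ideal.Quotient.mk (Ideal.span {f}) (MvPolynomial.X j) ∉ Q) →
      ∀ d : ℕ, ringKrullDim (Localization.AtPrime Q) = d → ∀ s : Fin d → Localization.AtPrime Q,
        (Ideal.span (Set.range s)).radical.IsMaximal →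
          RingTheory.Sequence.IsWeaklyRegular (Localization.AtPrime Q) (List.ofFn s) ∧
          ∀ y : Localization.AtPrime Q, (∃ e : ℕ, y ^ p ^ e ∈ Ideal.span
            ((fun z : Localization.AtPrime Q => z ^ p ^ e) ''
              (Ideal.span (Set.range s) : Set (Localization.AtPrime Q)))) → y ∈ Ideal.span (Set.range s))
    (hCN : ∀ (c : Fin t) (S : Finset (Fin n)), (∀ j ∈ J, 0 < ∑ i ∈ S, V c i j) →
      (∀ D : ℕ, (MvPolynomial.weightedHomogeneousComponent (fun j : Fin n => ∑ i ∈ S, V c i j) D f ≠ 0 ∧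
          ∀ D' < D, MvPolynomial.weightedHomogeneousComponent (fun j : Fin n => ∑ i ∈ S, V c i j) D' f = 0) →
        ∀ (K : Type) [Field K] [Algebra k K] (b : Fin n → K), (∀ i, b i ≠ 0) →
          MvPolynomial.aeval b (MvPolynomial.weightedHomogeneousComponent (fun j : Fin n => ∑ i ∈ S, V c i j) D f) = 0 →
          (MvPolynomial.map (algebraMap k K) (MvPolynomial.weightedHomogeneousComponent (fun j : Fin n => ∑ i ∈ S, V c i j) D f)) ^ (p - 1) ∉
            Ideal.span (Set.range fun i : Fin n => (MvPolynomial.X i - MvPolynomial.C (b i)) ^ p)))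
    (dv : Fin t → (Fin n →₀ ℕ)) (g : Fin t → MvPolynomial (Fin n) k)
    (hg : ∀ c, MvPolynomial.aeval (fun j : Fin n => ∏ i : Fin n, (MvPolynomial.X i : MvPolynomial (Fin n) k) ^ V c i j) f = MvPolynomial.monomial (dv c) 1 * g c)
    (hndiv : ∀ c, ∀ i : Fin n, ¬ (MvPolynomial.X i ∣ g c))
    (hface : ∀ c, ∃ m ∈ f.support, ∀ i : Fin n, ∑ j : Fin n, V c i j * m j = dv c i)
    (I : Ideal (MvPolynomial (Fin n) k ⧸ Ideal.span {f}))
    (hI : I = Ideal.span ((fun b : Fin n →₀ ℕ => Ideal.Quotient.mk (Ideal.span {f}) (MvPolynomial.monomial b (1 : k))) '' (A : Set (Fin n →₀ ℕ)))) :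
    ∀ y : ↥(affineBlowup I), IsDomain ((affineBlowup I).presheaf.stalk y) ∧
      ∀ d : ℕ, ringKrullDim ((affineBlowup I).presheaf.stalk y) = d →
        ∀ s : Fin d → (affineBlowup I).presheaf.stalk y, (Ideal.span (Set.range s)).radical.IsMaximal →
          RingTheory.Sequence.IsWeaklyRegular ((affineBlowup I).presheaf.stalk y) (List.ofFn s) ∧
          ∀ z : (affineBlowup I).presheaf.stalk y, (∃ e : ℕ, z ^ p ^ e ∈
              Ideal.span ((fun w : (affineBlowup I).presheaf.stalk y => w ^ p ^ e) ''
                (Ideal.span (Set.range s) : Set ((affineBlowup I).presheaf.stalk y)))) →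
            z ∈ Ideal.span (Set.range s) := by
  refine affineBlowup_fiClause_of_chartClauseRel p k n J A hAJ t ht m hm hcov f hfprime hXne hoff ?_ I hI
  intro c Q _ hQ
  exact chartClause_of_cnData p k n J hJ A hprim t V hV m a haA hgen hge f hfprime hXne hCN dv g hg hndiv hface c Q hQ

end Summit.ResolutionOfSingularities.ResolutionOfSingularities.Theorems.FInjectiveMacaulayfication.CNConeFiModelRelBlowup

end
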